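import Summits.FinalStateConjecture.FinalStateConjecture.Theses.PhaseMixingCapture
import Literature.Geometry.Lorentzian.TameGenericity
import Literature.Geometry.Lorentzian.TameFamilyOffCompact
import Literature.Geometry.Lorentzian.TameGenericityLocal
import Literature.Geometry.Lorentzian.AdiabaticTracking
import Literature.Geometry.Lorentzian.TrappedSurface

/-!
# Sketch — crux ideation for `CaptureSufficesTame` (stmt-FinalStateConjecture-17270), ideator 1, round 1

First-lemma signatures for the three idea cards
`hole-eats-the-mismatch`, `slide-and-kick`, `enter-once-uniform-entry`.
Everything here is a `def … : Prop` (a typed statement), plus one soft lemma PROVED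
(`summitMatrix_iff`) to make sure the summit matrix is copied verbatim. Nothing is asserted.
-/

-- the problem namespace `FinalStateConjecture.FinalStateConjecture` (single-conjunct summit) trips dupNamespace
set_option linter.dupNamespace false

noncomputable section

open scoped Manifold ContDiff Topology ENNReal
open Set Filter Function Literature.Geometry.Lorentzian

namespace Summit.FinalStateConjecture.FinalStateConjecture.Cruxes.CaptureSufficesTame.Ideator1

/-! ## §0 The summit matrix at one datum and late slices of a development -/

section Matrix

variable (X : Type) [TopologicalSpace X] [ChartedSpace E3 X] [IsManifold (𝓡 3) ∞ X]
  [T2Space X] [SecondCountableTopology X] [ConnectedSpace X]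

/-- The matrix of the (re-typed, T2) summit at ONE datum `D`: verbatim the `fun D ↦ …` of
`FinalStateConjecture`. -/
def SummitPropertyAt (D : InitialDataSet (𝓡 3) X) : Prop :=
  (∃ 𝒟 : VacuumCauchyDevelopment D, 𝒟.IsMaximal) ∧
    ∀ 𝒟 : VacuumCauchyDevelopment D, 𝒟.IsMaximal →
      Summit.FinalStateConjecture.HasCompleteNullInfinity 𝒟.toCauchyDevelopment ∧
        ∃ (O : Set 𝒟.carrier) (d : FinalStateDecomposition 𝒟.toSpacetime O 2),
          (∀ i, Kerr.IsSubextremal (d.mass i) (d.spin i)) ∧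
            O = Summit.FinalStateConjecture.exteriorOf 𝒟.toCauchyDevelopment d.charted ∧
              Summit.FinalStateConjecture.RaysStayInClosure 𝒟.toCauchyDevelopment O ∧
                Summit.FinalStateConjecture.HasExhaustiveCharts d ∧
                  Summit.FinalStateConjecture.IsFutureOriented d

/-- The censorship matrix at one datum (hypothesis `h₃ = WeakCosmicCensorshipTame` is its tame
genericity). -/
def CensoredAt (D : InitialDataSet (𝓡 3) X) : Prop :=
  (∃ 𝒟 : VacuumCauchyDevelopment D, 𝒟.IsMaximal) ∧
    ∀ 𝒟 : VacuumCauchyDevelopment D, 𝒟.IsMaximal →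
      Summit.FinalStateConjecture.HasCompleteNullInfinity 𝒟.toCauchyDevelopment

/-- Sanity: the summit is exactly the tame genericity of `SummitPropertyAt`. -/
theorem summitMatrix_iff :
    _root_.FinalStateConjecture ↔
      ∀ (X : Type) [TopologicalSpace X] [ChartedSpace E3 X] [IsManifold (𝓡 3) ∞ X] [T2Space X]
        [SecondCountableTopology X] [ConnectedSpace X],
        InitialDataSet.IsTameChristodoulouGeneric (admissibleVacuumData X) (SummitPropertyAt X) 1 :=
  Iff.rfl

end Matrix

section LateSlice

variable {X : Type} [TopologicalSpace X] [ChartedSpace E3 X] [IsManifold (𝓡 3) ∞ X]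
  [T2Space X] [SecondCountableTopology X] [ConnectedSpace X] {D : InitialDataSet (𝓡 3) X}

/-- A **late Cauchy re-slicing** of the vacuum development `𝒟` of `D` carrying the data `D'`
(on the same `3`-manifold `X`: all Cauchy hypersurfaces of a globally hyperbolic spacetime are
diffeomorphic): a second smooth embedding `j : X → M` with future unit normal, inducing `D'`,
whose image is a Cauchy hypersurface of `(M, g, τ)` contained in the causal future of `ι(X)`.
(Fields copied from `DataEmbedding` / `CauchyDevelopment`.) -/
structure LateSlice (𝒟 : VacuumCauchyDevelopment D) (D' : InitialDataSet (𝓡 3) X) where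
  embed' : X → 𝒟.carrier
  isSmoothEmbedding : Manifold.IsSmoothEmbedding (𝓡 3) (𝓡 4) ∞ embed'
  normal' : NormalField (𝓡 4) embed'
  isFutureUnitNormal : 𝒟.metric.IsFutureUnitNormal (𝓡 3) 𝒟.timeOrientation embed' normal'
  induced_h : ∀ y : X,
    pullbackBilin (I := 𝓡 4) (I' := 𝓡 3) embed' 𝒟.metric.val y = D'.h.inner y
  induced_k : ∀ [𝒟.metric.toPseudoRiemannianMetric.HasLeviCivita] (y : X),
    𝒟.metric.toPseudoRiemannianMetric.secondFundamentalForm (𝓡 3) embed' normal' y = D'.kBilin y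
  isCauchy : 𝒟.metric.IsCauchyHypersurface 𝒟.timeOrientation (range embed')
  late : range embed' ⊆ 𝒟.metric.causalFuture 𝒟.timeOrientation (range 𝒟.embed)

/-- The same spacetime viewed as a vacuum Cauchy development of the late data `D'`. -/
def LateSlice.toDevelopment {𝒟 : VacuumCauchyDevelopment D} {D' : InitialDataSet (𝓡 3) X}
    (S : LateSlice 𝒟 D') : VacuumCauchyDevelopment D' where
  toSpacetime := 𝒟.toSpacetime
  embed := S.embed'
  isSmoothEmbedding := S.isSmoothEmbedding
  normal := S.normal'
  isFutureUnitNormal := S.isFutureUnitNormal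
  induced_h := S.induced_h
  induced_k := S.induced_k
  isCauchyHypersurface := S.isCauchy
  isRicciFlat := 𝒟.isRicciFlat

/-- **No Killing initial data on `V`** (the hypothesis of Corvino–Schoen / Chruściel–Delay local
surjectivity on the collar `V`, in Moncrief's spacetime form, as in `IsKIDFreeAt` of the
`StationaryLimitReduction` line): every vector field smooth and Killing on an open set of the
development containing `ι(V)` vanishes on `ι(V)`. Intended for a CONNECTED collar `V` that reaches
from the exactly-Kerr layer into the genuinely dynamical interior of the hole. -/
def HasNoKIDOn (𝒟 : VacuumCauchyDevelopment D) (V : Set X) : Prop :=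
  haveI : 𝒟.metric.toPseudoRiemannianMetric.HasLeviCivita := 𝒟.metric.hasLeviCivita
  ∀ (W : Set 𝒟.carrier), IsOpen W → 𝒟.embed '' V ⊆ W →
    ∀ ξ : (p : 𝒟.carrier) → TangentSpace (𝓡 4) p,
      ContMDiffOn (𝓡 4) ((𝓡 4).prod 𝓘(ℝ, E4)) ∞
        (fun p ↦ (Bundle.TotalSpace.mk' E4 p (ξ p) : TangentBundle (𝓡 4) 𝒟.carrier)) W →
      (∀ p ∈ W, ∀ Y₀ Z₀ : TangentSpace (𝓡 4) p,
        𝒟.metric.val p (𝒟.metric.toPseudoRiemannianMetric.leviCivita ξ p Y₀) Z₀ +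
          𝒟.metric.val p Y₀ (𝒟.metric.toPseudoRiemannianMetric.leviCivita ξ p Z₀) = 0) →
      ∀ x ∈ V, ξ (𝒟.embed x) = 0

end LateSlice

/-! ## §1 Card `slide-and-kick`: the tame witness calculus -/

section WitnessCalculus

/-- **Late-slice transfer of the summit matrix** (support lemma every late-time mechanism needs):
if a late Cauchy re-slicing of an MGHD of the admissible datum `d` carries data `d'` (NOT asked
admissible: Kerr–Schild leaves are not DR-flat, `Kerr.not_isStronglyAsymptoticallyFlatDR_data`)
satisfying the summit matrix, then `d` satisfies it (same spacetime; `J⁺(j X) ⊆ J⁺(ι X)`; rays from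
`ι X` are affine reparametrisations of rays from `j X` after crossing; causal bookkeeping of
`exteriorOf` / `HasExhaustiveCharts` / `RaysStayInClosure`). -/
def LateSliceTransfer : Prop :=
  ∀ (X : Type) [TopologicalSpace X] [ChartedSpace E3 X] [IsManifold (𝓡 3) ∞ X] [T2Space X]
    [SecondCountableTopology X] [ConnectedSpace X],
    ∀ d ∈ admissibleVacuumData X, ∀ 𝒟 : VacuumCauchyDevelopment d, 𝒟.IsMaximal →
      ∀ (d' : InitialDataSet (𝓡 3) X) (_S : LateSlice 𝒟 d'),
        SummitPropertyAt X d' → SummitPropertyAt X d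

/-- **Backward transport of late compact kicks** (first lemma of `slide-and-kick`; time-reversed
Cauchy stability on the compact past `J⁻(j K) ∩ J⁺(ι X)` of the kick, domain of dependence off it):
every jointly smooth one-parameter family `G` of vacuum data through the late data `d'`, agreeing
with `d'` off a compact set, is realised — for small parameters — by a jointly smooth family `F` of
ADMISSIBLE data through `d` agreeing with `d` off a compact set (hence TAME on every collared end,
`isTameDataFamily_restrict_of_agree_off_compact_one`, mass constant), such that every MGHD of `F c`
re-slices late to the kicked data `G c` (so every future property of `MGHD(G c)` is a property of
`MGHD(F c)`). -/
def BackwardTransport : Prop :=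
  ∀ (X : Type) [TopologicalSpace X] [ChartedSpace E3 X] [IsManifold (𝓡 3) ∞ X] [T2Space X]
    [SecondCountableTopology X] [ConnectedSpace X],
    ∀ d ∈ admissibleVacuumData X, ∀ 𝒟 : VacuumCauchyDevelopment d, 𝒟.IsMaximal →
      ∀ (d' : InitialDataSet (𝓡 3) X) (_S : LateSlice 𝒟 d')
        (G : EuclideanSpace ℝ (Fin 1) → InitialDataSet (𝓡 3) X) (K : Set X),
        IsCompact K → InitialDataSet.IsSmoothDataFamily 1 G → G 0 = d' →
        (∀ c, ∀ x ∉ K, (G c).h.inner x = d'.h.inner x ∧ (G c).k x = d'.k x) →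
        (∀ c, ∀ [(G c).metric.HasLeviCivita], (G c).IsVacuumConstraintSolution) →
        ∃ ε > (0 : ℝ), ∃ (F : EuclideanSpace ℝ (Fin 1) → InitialDataSet (𝓡 3) X) (K₀ : Set X),
          IsCompact K₀ ∧ InitialDataSet.IsSmoothDataFamily 1 F ∧ F 0 = d ∧
          (∀ c, ∀ x ∉ K₀, (F c).h.inner x = d.h.inner x ∧ (F c).k x = d.k x) ∧
          (∀ c, ‖c‖ < ε → F c ∈ admissibleVacuumData X) ∧
          ∀ c, ‖c‖ < ε → ∀ 𝒟c : VacuumCauchyDevelopment (F c), 𝒟c.IsMaximal →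
            Nonempty (LateSlice 𝒟c (G c))

/-- **Immersion criterion** (infinitesimal part of `BackwardTransport`): the transported family is
immersed at `0` as soon as the late kick's tangent is not the tangent of a re-slicing of the SAME
spacetime (not "slice gauge"): typed as — if NO jointly smooth family of late slices of `𝒟` itself
has the kick's first-order data, then `F` is immersed. (Linearised vacuum perturbations with
vanishing linearised Cauchy data are infinitesimal diffeomorphisms.) -/
def ImmersedOfNonGaugeKick : Prop :=
  ∀ (X : Type) [TopologicalSpace X] [ChartedSpace E3 X] [IsManifold (𝓡 3) ∞ X] [T2Space X]
    [SecondCountableTopology X] [ConnectedSpace X],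
    ∀ d ∈ admissibleVacuumData X, ∀ 𝒟 : VacuumCauchyDevelopment d, 𝒟.IsMaximal →
      ∀ (d' : InitialDataSet (𝓡 3) X) (_S : LateSlice 𝒟 d')
        (G F : EuclideanSpace ℝ (Fin 1) → InitialDataSet (𝓡 3) X),
        InitialDataSet.IsSmoothDataFamily 1 G → G 0 = d' →
        InitialDataSet.IsSmoothDataFamily 1 F → F 0 = d →
        -- `F` realises `G` late (conclusion of `BackwardTransport`, member by member near `0`)
        (∀ᶠ c in 𝓝 0, ∀ 𝒟c : VacuumCauchyDevelopment (F c), 𝒟c.IsMaximal →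
          Nonempty (LateSlice 𝒟c (G c))) →
        -- the kick is not slice gauge: no smooth family of re-slicings of `𝒟` itself has the
        -- same first-order data as `G` at `0`
        (¬ ∃ (E : EuclideanSpace ℝ (Fin 1) → InitialDataSet (𝓡 3) X),
            InitialDataSet.IsSmoothDataFamily 1 E ∧ E 0 = d' ∧ (∀ c, Nonempty (LateSlice 𝒟 (E c))) ∧
            ∀ (x : X) (u w : TangentSpace (𝓡 3) x),
              fderiv ℝ (fun c ↦ (E c).h.inner x u w) 0 = fderiv ℝ (fun c ↦ (G c).h.inner x u w) 0 ∧
              fderiv ℝ (fun c ↦ (E c).k x u w) 0 = fderiv ℝ (fun c ↦ (G c).k x u w) 0) →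
        InitialDataSet.IsImmersedAtZero 1 G → InitialDataSet.IsImmersedAtZero 1 F

/-- The slide axis `c ↦ (c, 0)` as a continuous linear map `ℝ¹ →L ℝ²`. -/
def slideAxisL : EuclideanSpace ℝ (Fin 1) →L[ℝ] EuclideanSpace ℝ (Fin 2) :=
  (EuclideanSpace.proj (0 : Fin 1)).smulRight (EuclideanSpace.single (0 : Fin 2) (1 : ℝ))

@[simp] theorem slideAxisL_apply (v : EuclideanSpace ℝ (Fin 1)) :
    slideAxisL v = (v 0) • EuclideanSpace.single (0 : Fin 2) (1 : ℝ) := rfl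

/-- **Slide-and-kick** (soft; the structural lemma of the card, PROVED below as `slideAndKick`):
tame codimension `≥ 1` of `𝓔` in `𝓓` follows if through every `d ∈ 𝓔` there is a jointly smooth
TWO-parameter family `H (c, s)` with `H (c, 0) =` a tame SLIDE curve through `d` (no membership
condition on the slide — typically time translation along the development, which stays inside `𝓔`),
immersed along the slide axis (some scalar component of `H` has non-zero derivative at `0` in the
direction `(v, 0)`), injective OFF the kick support `K` (so the kick cannot undo it), every
`H (c, s)` agreeing with the slide member `H (c, 0)` off `K`, all members in `𝓓`, and
`H (c, s) ∉ 𝓔` for all small `(c, s)` with `s > 0` (ONE-SIDED in the kick). Witness: the parabola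
`c ↦ H (ψ c, (ψ c)²)` for a radial contraction `ψ`; immersion and injectivity come from the slide,
escape from the kick, tameness from both (on a collared restriction of `e`). -/
def SlideAndKick : Prop :=
  ∀ (X : Type) [TopologicalSpace X] [ChartedSpace E3 X] [IsManifold (𝓡 3) ∞ X] [T2Space X]
    [SecondCountableTopology X] [ConnectedSpace X] (𝓓 𝓔 : Set (InitialDataSet (𝓡 3) X)),
    (∀ d ∈ 𝓔, ∃ (e : AFEnd X) (H : EuclideanSpace ℝ (Fin 2) → InitialDataSet (𝓡 3) X) (K : Set X),
      InitialDataSet.IsSmoothDataFamily 2 H ∧ H 0 = d ∧ IsCompact K ∧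
      InitialDataSet.IsTameDataFamily e 1 (fun c ↦ H (slideAxisL c)) ∧
      -- immersed along the slide axis
      (∀ v : EuclideanSpace ℝ (Fin 1), v ≠ 0 → ∃ (x : X) (u w : TangentSpace (𝓡 3) x),
        fderiv ℝ (fun p ↦ (H p).h.inner x u w) 0 (slideAxisL v) ≠ 0 ∨
          fderiv ℝ (fun p ↦ (H p).k x u w) 0 (slideAxisL v) ≠ 0) ∧
      -- the slide is injective OFF the kick support (so the kick cannot undo it)
      (∀ c₁ c₂ : EuclideanSpace ℝ (Fin 1),
        (∀ x ∉ K, (H (slideAxisL c₁)).h.inner x = (H (slideAxisL c₂)).h.inner x ∧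
          (H (slideAxisL c₁)).k x = (H (slideAxisL c₂)).k x) → c₁ = c₂) ∧
      -- every member agrees with its slide member off `K`
      (∀ p : EuclideanSpace ℝ (Fin 2), ∀ x ∉ K,
        (H p).h.inner x = (H (slideAxisL (EuclideanSpace.single (0 : Fin 1) (p 0)))).h.inner x ∧
        (H p).k x = (H (slideAxisL (EuclideanSpace.single (0 : Fin 1) (p 0)))).k x) ∧
      (∀ p, H p ∈ 𝓓) ∧
      ∃ ε > (0 : ℝ), ∀ p : EuclideanSpace ℝ (Fin 2), ‖p‖ < ε → 0 < p 1 → H p ∉ 𝓔) →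
    InitialDataSet.HasTameCodimAtLeastIn 𝓓 𝓔 1

/-- Restriction of an end does not increase the weighted distance (the `iSup` runs over the
smaller region `R₁ < ‖x‖`). -/
theorem wDist_restrict_le {X : Type} [TopologicalSpace X] [ChartedSpace E3 X] [IsManifold (𝓡 3) ∞ X]
    (e : AFEnd X) {R₁ : ℝ} (hR₁ : e.R ≤ R₁) (D D' : InitialDataSet (𝓡 3) X) :
    (e.restrict hR₁).wDist D D' ≤ e.wDist D D' := by
  rw [e.wDist_restrict_eq hR₁ D D']
  unfold AFEnd.wDist
  gcongr with m hm x <;> exact iSup_mono' fun hx ↦ ⟨lt_of_le_of_lt hR₁ hx, le_rfl⟩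

/-- Two pairs of data whose chart components agree beyond `R' < R₁` have the same weighted
distance on the end restricted to `R₁`. -/
theorem wDist_restrict_congr {X : Type} [TopologicalSpace X] [ChartedSpace E3 X] [IsManifold (𝓡 3) ∞ X]
    (e : AFEnd X) {R' R₁ : ℝ} (hR₁ : e.R ≤ R₁) (hR' : R' < R₁)
    {D₁ D₁' D₂ D₂' : InitialDataSet (𝓡 3) X}
    (hh : ∀ y : E3, R' < ‖y‖ → e.hCoeff D₁ y = e.hCoeff D₂ y)
    (hh' : ∀ y : E3, R' < ‖y‖ → e.hCoeff D₁' y = e.hCoeff D₂' y)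
    (hk : ∀ y : E3, R' < ‖y‖ → e.kCoeff D₁ y = e.kCoeff D₂ y)
    (hk' : ∀ y : E3, R' < ‖y‖ → e.kCoeff D₁' y = e.kCoeff D₂' y) :
    (e.restrict hR₁).wDist D₁ D₁' = (e.restrict hR₁).wDist D₂ D₂' := by
  rw [e.wDist_restrict_eq hR₁, e.wDist_restrict_eq hR₁]
  have hopen : IsOpen {y : E3 | R' < ‖y‖} := isOpen_lt continuous_const continuous_norm
  congr 1
  · refine iSup_congr fun m ↦ iSup_congr fun _ ↦ iSup_congr fun x ↦ iSup_congr fun hx ↦ ?_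
    have hev : (fun y ↦ e.hCoeff D₁ y - e.hCoeff D₁' y) =ᶠ[𝓝 x]
        fun y ↦ e.hCoeff D₂ y - e.hCoeff D₂' y := by
      filter_upwards [hopen.mem_nhds (show R' < ‖x‖ from hR'.trans hx)] with y hy
      rw [hh y hy, hh' y hy]
    rw [(hev.iteratedFDeriv ℝ m).eq_of_nhds]
  · refine iSup_congr fun m ↦ iSup_congr fun _ ↦ iSup_congr fun x ↦ iSup_congr fun hx ↦ ?_
    have hev : (fun y ↦ e.kCoeff D₁ y - e.kCoeff D₁' y) =ᶠ[𝓝 x]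
        fun y ↦ e.kCoeff D₂ y - e.kCoeff D₂' y := by
      filter_upwards [hopen.mem_nhds (show R' < ‖x‖ from hR'.trans hx)] with y hy
      rw [hk y hy, hk' y hy]
    rw [(hev.iteratedFDeriv ℝ m).eq_of_nhds]

/-- The norm of a vector of `ℝ¹` is the absolute value of its coordinate. -/
theorem norm_fin_one (v : EuclideanSpace ℝ (Fin 1)) : ‖v‖ = |v 0| := by
  rw [EuclideanSpace.norm_eq]
  simp [Real.sqrt_sq_eq_abs]

/-- A vector of `ℝ¹` is the `single` of its coordinate. -/
theorem single_apply_zero_fin_one (v : EuclideanSpace ℝ (Fin 1)) :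
    EuclideanSpace.single (0 : Fin 1) (v 0) = v := by
  ext i
  fin_cases i
  simp

/-- **Slide-and-kick, PROVED.** -/
theorem slideAndKick : SlideAndKick := by
  intro X _ _ _ _ _ _ 𝓓 𝓔 hyp d hd
  obtain ⟨e, H, K, hH, hH0, hK, hslide, himm, hinjK, hagree, h𝓓, ε, hε, hesc⟩ := hyp d hd
  -- notation
  set S : EuclideanSpace ℝ (Fin 1) → InitialDataSet (𝓡 3) X := fun c ↦ H (slideAxisL c) with hS
  set b₀ : EuclideanSpace ℝ (Fin 2) := EuclideanSpace.single (0 : Fin 2) (1 : ℝ) with hb₀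
  set b₁ : EuclideanSpace ℝ (Fin 2) := EuclideanSpace.single (1 : Fin 2) (1 : ℝ) with hb₁
  -- the radial contraction of the slide parameter into the `δ`-ball
  set δ : ℝ := min (ε / 2) (1 / 2) with hδ
  have hδpos : 0 < δ := lt_min (by linarith) (by norm_num)
  have hδε : δ ≤ ε / 2 := min_le_left _ _
  have hδhalf : δ ≤ 1 / 2 := min_le_right _ _
  obtain ⟨ψ, hψs, hψinj, hψ0, hψlt, hψz, hψd⟩ :=
    exists_contDiff_radialContraction (V := EuclideanSpace ℝ (Fin 1)) hδpos
  -- the coordinate `t c = (ψ c) 0` and the parabola `φ c = t c • b₀ + (t c)² • b₁`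
  set t : EuclideanSpace ℝ (Fin 1) → ℝ := fun c ↦ (ψ c) 0 with ht
  have ht_smooth : ContDiff ℝ ∞ t :=
    (EuclideanSpace.proj 0 : EuclideanSpace ℝ (Fin 1) →L[ℝ] ℝ).contDiff.comp hψs
  have ht0 : t 0 = 0 := by simp [ht, hψ0]
  have ht_abs : ∀ c, |t c| = ‖ψ c‖ := fun c ↦ (norm_fin_one (ψ c)).symm
  have ht_ne : ∀ c, c ≠ 0 → t c ≠ 0 := by
    intro c hc htc
    have : ψ c = 0 := by
      rw [← norm_eq_zero, ← ht_abs, htc, abs_zero]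
    exact hc (hψz c this)
  set φ : EuclideanSpace ℝ (Fin 1) → EuclideanSpace ℝ (Fin 2) := fun c ↦ t c • b₀ + (t c * t c) • b₁
    with hφ
  have hφ_smooth : ContDiff ℝ ∞ φ :=
    (ht_smooth.smul contDiff_const).add ((ht_smooth.mul ht_smooth).smul contDiff_const)
  have hφ0 : φ 0 = 0 := by simp [hφ, ht0]
  have hφ_fst : ∀ c, (φ c) 0 = t c := by
    intro c; simp [hφ, hb₀, hb₁]
  have hφ_snd : ∀ c, (φ c) 1 = t c * t c := by
    intro c; simp [hφ, hb₀, hb₁]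
  have hφ_norm : ∀ c, ‖φ c‖ < ε := by
    intro c
    have h1 : ‖t c • b₀‖ = |t c| := by rw [norm_smul, hb₀, PiLp.norm_single, norm_one, mul_one, Real.norm_eq_abs]
    have h2 : ‖(t c * t c) • b₁‖ = |t c| * |t c| := by
      rw [norm_smul, hb₁, PiLp.norm_single, norm_one, mul_one, Real.norm_eq_abs, abs_mul]
    have htc : |t c| < δ := by rw [ht_abs]; exact hψlt c
    have habs : 0 ≤ |t c| := abs_nonneg _
    calc ‖φ c‖ ≤ ‖t c • b₀‖ + ‖(t c * t c) • b₁‖ := norm_add_le _ _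
      _ = |t c| + |t c| * |t c| := by rw [h1, h2]
      _ ≤ δ + δ * δ := by nlinarith
      _ < ε := by nlinarith
  -- slide member of the parabola point
  have hslide_of : ∀ c, slideAxisL (EuclideanSpace.single (0 : Fin 1) ((φ c) 0)) = slideAxisL (ψ c) := by
    intro c
    rw [hφ_fst c, show t c = (ψ c) 0 from rfl, single_apply_zero_fin_one]
  -- the derivative of the parabola at `0` is `δ •` the slide axis
  have hψ_diff : DifferentiableAt ℝ ψ 0 := hψs.differentiable (by simp) 0
  set t' : EuclideanSpace ℝ (Fin 1) →L[ℝ] ℝ :=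
    (EuclideanSpace.proj 0 : EuclideanSpace ℝ (Fin 1) →L[ℝ] ℝ).comp (fderiv ℝ ψ 0) with ht'
  have ht_deriv : HasFDerivAt t t' 0 :=
    (EuclideanSpace.proj 0 : EuclideanSpace ℝ (Fin 1) →L[ℝ] ℝ).hasFDerivAt.comp 0 hψ_diff.hasFDerivAt
  have ht'_apply : ∀ v, t' v = δ * v 0 := by
    intro v
    simp [ht', hψd]
  have hφ_deriv : HasFDerivAt φ (t'.smulRight b₀ + ((t 0) • t' + (t 0) • t').smulRight b₁) 0 :=
    (ht_deriv.smul_const b₀).add ((ht_deriv.mul ht_deriv).smul_const b₁)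
  have hφ_diff : DifferentiableAt ℝ φ 0 := hφ_deriv.differentiableAt
  have hφ_fderiv : ∀ v, fderiv ℝ φ 0 v = δ • slideAxisL v := by
    intro v
    rw [hφ_deriv.fderiv]
    simp [ht'_apply, ht0, hb₀, smul_smul]
  -- (1) immersion of the parabola family, from immersion along the slide axis
  have himmF : InitialDataSet.IsImmersedAtZero 1 (fun c ↦ H (φ c)) := by
    intro v hv
    obtain ⟨x, u, w, huw⟩ := himm v hv
    refine ⟨x, u, w, ?_⟩
    have chain : ∀ g : EuclideanSpace ℝ (Fin 2) → ℝ, fderiv ℝ g 0 (slideAxisL v) ≠ 0 →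
        fderiv ℝ (fun c ↦ g (φ c)) 0 v ≠ 0 := by
      intro g hg
      have hgd : DifferentiableAt ℝ g (φ 0) := by
        rw [hφ0]
        by_contra hnd
        rw [fderiv_zero_of_not_differentiableAt hnd] at hg
        exact hg rfl
      have hc : fderiv ℝ (fun c ↦ g (φ c)) 0 = (fderiv ℝ g (φ 0)).comp (fderiv ℝ φ 0) :=
        fderiv_comp 0 hgd hφ_diff
      rw [hc, ContinuousLinearMap.comp_apply, hφ_fderiv, hφ0, map_smul]
      exact smul_ne_zero hδpos.ne' hg
    rcases huw with h | h
    · exact Or.inl (chain (fun p ↦ (H p).h.inner x u w) h)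
    · exact Or.inr (chain (fun p ↦ (H p).k x u w) h)
  -- (2) a far region missing `K`, and the collared end
  obtain ⟨R₀, hR₀⟩ := e.exists_forall_far_disjoint hK
  have hfarK : ∀ q ∈ e.far R₀, q ∉ K :=
    fun q hq hqK ↦ Set.disjoint_left.1 (hR₀ R₀ le_rfl) hq hqK
  set R₁ : ℝ := max R₀ e.R + 1 with hR₁
  have hR₁e : e.R ≤ R₁ := by
    have := le_max_right R₀ e.R
    linarith
  have hR₁lt : ∀ z : E3, R₁ < ‖z‖ → max R₀ e.R < ‖z‖ := fun z hz ↦ by linarith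
  -- every member agrees with its slide member off `K`
  have hagreeF : ∀ c, ∀ x ∉ K,
      (H (φ c)).h.inner x = (S (ψ c)).h.inner x ∧ (H (φ c)).k x = (S (ψ c)).k x := by
    intro c x hx
    have h := hagree (φ c) x hx
    rwa [hslide_of c] at h
  have hcoeff_h : ∀ c (y : E3), max R₀ e.R < ‖y‖ → e.hCoeff (H (φ c)) y = e.hCoeff (S (ψ c)) y :=
    fun c y hy ↦ e.hCoeff_eq_of_agree_far (fun q hq ↦ (hagreeF c q (hfarK q hq)).1) hy
  have hcoeff_k : ∀ c (y : E3), max R₀ e.R < ‖y‖ → e.kCoeff (H (φ c)) y = e.kCoeff (S (ψ c)) y :=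
    fun c y hy ↦ e.kCoeff_eq_of_agree_far (fun q hq ↦ (hagreeF c q (hfarK q hq)).2) hy
  -- (3) tameness of the parabola family on the collared end
  obtain ⟨-, hsole, ⟨M, hMc, hSAF⟩, hlim⟩ := hslide
  have hR'lt : max R₀ e.R < R₁ := by simp [hR₁]
  have hstepA : ∀ c, (e.restrict hR₁e).wDist (H (φ c)) (H (φ 0)) =
      (e.restrict hR₁e).wDist (S (ψ c)) (S (ψ 0)) := fun c ↦
    wDist_restrict_congr e hR₁e hR'lt (hcoeff_h c) (hcoeff_h 0) (hcoeff_k c) (hcoeff_k 0)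
  have htame : InitialDataSet.IsTameDataFamily (e.restrict hR₁e) 1 (fun c ↦ H (φ c)) := by
    refine ⟨hH.comp_contDiff hφ_smooth, (e.isSoleEnd_restrict_iff hR₁e).2 hsole,
      ⟨fun c ↦ M (ψ c), hMc.comp hψs.continuous, fun c ↦ ?_⟩, ?_⟩
    · rw [e.isStronglyAsymptoticallyFlatDR_restrict_iff hR₁e]
      exact (hSAF (ψ c)).congr_of_eqOn_far (R₀ := R₀) (fun q hq ↦ (hagreeF c q (hfarK q hq)).1)
        (fun q hq ↦ (hagreeF c q (hfarK q hq)).2)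
    · have hψcont : Tendsto ψ (𝓝 0) (𝓝 0) := by
        simpa [hψ0] using hψs.continuous.tendsto 0
      have hlim' : Tendsto (fun c ↦ e.wDist (S (ψ c)) (S 0)) (𝓝 0) (𝓝 0) := hlim.comp hψcont
      refine tendsto_of_tendsto_of_tendsto_of_le_of_le tendsto_const_nhds hlim'
        (fun _ ↦ zero_le) fun c ↦ ?_
      show (e.restrict hR₁e).wDist (H (φ c)) (H (φ 0)) ≤ e.wDist (S (ψ c)) (S 0)
      rw [hstepA c, hψ0]
      exact wDist_restrict_le e hR₁e _ _
  -- (4) injectivity, from injectivity of the slide off `K`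
  have hinjF : Injective (fun c ↦ H (φ c)) := by
    intro c₁ c₂ h
    have h' : H (φ c₁) = H (φ c₂) := h
    refine hψinj (hinjK (ψ c₁) (ψ c₂) fun x hx ↦ ?_)
    obtain ⟨h1, k1⟩ := hagreeF c₁ x hx
    obtain ⟨h2, k2⟩ := hagreeF c₂ x hx
    exact ⟨by rw [← h1, ← h2, h'], by rw [← k1, ← k2, h']⟩
  -- (5) assemble
  refine ⟨e.restrict hR₁e, fun c ↦ H (φ c), htame, himmF, ?_, hinjF, fun c ↦ h𝓓 _, fun c hc ↦ ?_⟩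
  · show H (φ 0) = d
    rw [hφ0, hH0]
  · refine hesc (φ c) (hφ_norm c) ?_
    rw [hφ_snd]
    exact mul_self_pos.2 (ht_ne c hc)

end WitnessCalculus

/-! ## §2 Card `hole-eats-the-mismatch`: late moduli surgery behind the horizon -/

section Surgery

/-- **Exactly Kerr outside a compact set, closed spin range** (`|a| ≤ M`, extremal allowed; the
junction radius `r₁ < r₊` sits INSIDE the black hole): the datum `D` on `X`, off a compact set, is
the pull-back along an open embedding `φ` of the Kerr–Schild slice datum `Kerr.data M a r₁` on
`{t* = 0, r > r₁}`. (The sub-extremal, bent-slice version is `ParametricKerrBurial.IsKerrShieldedWith`;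
here the plain KS leaf, so that `a = ±M` makes sense.) -/
def IsExactKerrOutside [Kerr.Facts] [Kerr.SliceFacts] (M a r₁ : ℝ) (X : Type) [TopologicalSpace X]
    [ChartedSpace E3 X] [IsManifold (𝓡 3) ∞ X] (D : InitialDataSet (𝓡 3) X) : Prop :=
  ∃ (hM : 0 < M) (φ : Kerr.slice a r₁ → X),
    |a| ≤ M ∧ 0 < r₁ ∧ r₁ < Kerr.rPlus M a ∧
    IsCompact (Set.range φ)ᶜ ∧ Topology.IsOpenEmbedding φ ∧ ContMDiff 𝓘(ℝ, E3) (𝓡 3) ∞ φ ∧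
    (∀ y : Kerr.slice a r₁,
      pullbackBilin (I := 𝓡 3) (I' := 𝓘(ℝ, E3)) φ D.h.inner y = (Kerr.data M a r₁ hM.le).h.inner y) ∧
    (∀ y : Kerr.slice a r₁,
      pullbackBilin (I := 𝓡 3) (I' := 𝓘(ℝ, E3)) φ D.k y = (Kerr.data M a r₁ hM.le).k y)

/-- **The hole eats the mismatch — exact stratum** (first lemma of the card, theorem-sized):
an admissible datum one of whose MGHDs re-slices late to data that are EXACTLY Kerr `(M, a)`,
`|a| ≤ M` (extremal parking allowed), outside a compact set sitting inside the black hole, admits a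
TAME, immersed, injective admissible curve through it all of whose other nearby members have MGHDs
re-slicing late to data exactly SUB-extremal-Kerr outside a compact set inside their black hole
(moduli re-dial `(M, a) ↦ (M + c², a)` glued in the KID-free interior collar, transported back over
the fixed time by weighted backward Cauchy stability, slid along time translation for immersion).
With `KerrShieldedSettles`-type exact settling and `LateSliceTransfer` this is a witness of the
summit matrix: exact-exterior parking is tame-codimension `≥ 1` with no near-extremal dynamics. -/
def ExactExteriorUnparks : Prop :=
  ∀ [Kerr.Facts] [Kerr.SliceFacts] (X : Type) [TopologicalSpace X] [ChartedSpace E3 X]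
    [IsManifold (𝓡 3) ∞ X] [T2Space X] [SecondCountableTopology X] [ConnectedSpace X],
    ∀ d ∈ admissibleVacuumData X, ∀ 𝒟 : VacuumCauchyDevelopment d, 𝒟.IsMaximal →
      ∀ (M a r₁ : ℝ) (d' : InitialDataSet (𝓡 3) X) (S : LateSlice 𝒟 d'),
        IsExactKerrOutside M a r₁ X d' →
        -- the gluing collar: a connected open set of the late slice, KID-free (it reaches the
        -- dynamical interior of the hole), on which the moduli mismatch is dumped
        (∃ V : Set X, IsOpen V ∧ IsConnected V ∧ IsCompact (closure V) ∧
          HasNoKIDOn S.toDevelopment V) →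
        ∃ (e : AFEnd X) (F : EuclideanSpace ℝ (Fin 1) → InitialDataSet (𝓡 3) X),
          InitialDataSet.IsTameDataFamily e 1 F ∧ InitialDataSet.IsImmersedAtZero 1 F ∧ F 0 = d ∧
          Injective F ∧ (∀ c, F c ∈ admissibleVacuumData X) ∧
          ∃ ε > (0 : ℝ), ∀ c : EuclideanSpace ℝ (Fin 1), c ≠ 0 → ‖c‖ < ε →
            ∃ (M' a' r₁' : ℝ), Kerr.IsSubextremal M' a' ∧
              ∀ 𝒟c : VacuumCauchyDevelopment (F c), 𝒟c.IsMaximal →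
                ∃ (dc' : InitialDataSet (𝓡 3) X) (_Sc : LateSlice 𝒟c dc'),
                  (∀ [dc'.metric.HasLeviCivita], dc'.IsVacuumConstraintSolution) ∧
                    IsExactKerrOutside M' a' r₁' X dc'

/-- **Exact shielded data settle (T2 form)** — the finishing fact for the exact stratum: a smooth
vacuum datum on `X` exactly sub-extremal-Kerr (Kerr–Schild leaf) outside a compact set inside the
hole satisfies the summit matrix (content of the pre-revision `SwallowTheDatum.KerrShieldedSettles`,
here on the plain KS leaf and without DR-admissibility — the late leaf of a member is not DR-flat —
plus the two audit conjuncts `RaysStayInClosure`, `IsFutureOriented`; the exact region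
`{r > max(r₁, r₋)}` lies in `D⁺` of the exact data, charts exact and horizon-pinned). -/
def ExactShieldedSettlesT2 : Prop :=
  ∀ [Kerr.Facts] [Kerr.SliceFacts] (X : Type) [TopologicalSpace X] [ChartedSpace E3 X]
    [IsManifold (𝓡 3) ∞ X] [T2Space X] [SecondCountableTopology X] [ConnectedSpace X],
    ∀ (D : InitialDataSet (𝓡 3) X), (∀ [D.metric.HasLeviCivita], D.IsVacuumConstraintSolution) →
      ∀ (M a r₁ : ℝ), Kerr.IsSubextremal M a → IsExactKerrOutside M a r₁ X D → SummitPropertyAt X D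

/-- Composition check (pure logic): the exact-stratum package gives tame witnesses of the summit
matrix through every exact-exterior parking datum. -/
theorem hasWitness_of_exactExterior [Kerr.Facts] [Kerr.SliceFacts]
    (hU : ExactExteriorUnparks) (hS : ExactShieldedSettlesT2) (hT : LateSliceTransfer)
    {X : Type} [TopologicalSpace X] [ChartedSpace E3 X] [IsManifold (𝓡 3) ∞ X] [T2Space X]
    [SecondCountableTopology X] [ConnectedSpace X]
    -- MGHD existence for admissible data (Choquet-Bruhat–Geroch, vendored fact shape)
    (hCBG : ∀ D ∈ admissibleVacuumData X, ∃ 𝒟 : VacuumCauchyDevelopment D, 𝒟.IsMaximal)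
    {d : InitialDataSet (𝓡 3) X} (hd : d ∈ admissibleVacuumData X)
    (𝒟 : VacuumCauchyDevelopment d) (h𝒟 : 𝒟.IsMaximal) {M a r₁ : ℝ} {d' : InitialDataSet (𝓡 3) X}
    (S : LateSlice 𝒟 d') (hex : IsExactKerrOutside M a r₁ X d')
    (hV : ∃ V : Set X, IsOpen V ∧ IsConnected V ∧ IsCompact (closure V) ∧
      HasNoKIDOn S.toDevelopment V) :
    ∃ (e : AFEnd X) (F : EuclideanSpace ℝ (Fin 1) → InitialDataSet (𝓡 3) X),
      InitialDataSet.IsTameDataFamily e 1 F ∧ InitialDataSet.IsImmersedAtZero 1 F ∧ F 0 = d ∧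
      Injective F ∧ (∀ c, F c ∈ admissibleVacuumData X) ∧
      ∃ ε > (0 : ℝ), ∀ c : EuclideanSpace ℝ (Fin 1), c ≠ 0 → ‖c‖ < ε → SummitPropertyAt X (F c) := by
  obtain ⟨e, F, hF, himm, h0, hinj, hadm, ε, hε, hmem⟩ := hU X d hd 𝒟 h𝒟 M a r₁ d' S hex hV
  refine ⟨e, F, hF, himm, h0, hinj, hadm, ε, hε, fun c hc hcε ↦ ?_⟩
  obtain ⟨M', a', r₁', hsub, hlate⟩ := hmem c hc hcε
  obtain ⟨𝒟c, h𝒟c⟩ := hCBG (F c) (hadm c)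
  obtain ⟨dc', Sc, hvac', hex'⟩ := hlate 𝒟c h𝒟c
  exact hT X (F c) (hadm c) 𝒟c h𝒟c dc' Sc (hS X dc' hvac' M' a' r₁' hsub hex')

end Surgery

/-! ## §3 Card `enter-once-uniform-entry`: uniform ENTRY radius, polynomial dwell -/

section EnterOnce

/-- **Tracked ONCE at accuracy `ε₀`**: ONE window `[0, L]` of the development (in its own
charts, near-zone radius `R ≥ R₀`) is `ε₀`-tracked by an `N`-Kerr configuration with masses in
`[m₀, m₀⁻¹]` and spin bound `|aᵢ| ≤ χ Mᵢ` (`χ = 1`: no margin — the chart Kerrs are sub-extremal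
by `ApproximateKerrConfiguration.abs_spin_lt_mass`, but may sit arbitrarily close to
extremality), the window being an honest cross-section of the exterior it determines: with
`O := J⁺(ι X) ∩ I⁻(window image)`, `O ⊆ J⁻(start slab) ∪ window image`. (= one element of the
chain of the tree's `IsAdiabaticallyTracked`, with its pinning and covering clauses.) -/
def TrackedOnce {X : Type} [TopologicalSpace X] [ChartedSpace E3 X] [IsManifold (𝓡 3) ∞ X]
    [T2Space X] [SecondCountableTopology X] [ConnectedSpace X] {D : InitialDataSet (𝓡 3) X}
    (𝒟 : VacuumCauchyDevelopment D) (N : ℕ) (m₀ χ : ℝ) (ε₀ : ℝ≥0∞) (L R₀ : ℝ) : Prop :=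
  ∃ (R : ℝ) (O : Set 𝒟.carrier) (c : ApproximateKerrConfiguration 𝒟.toSpacetime O 2 ε₀ 0 L R),
    R₀ ≤ R ∧ c.N = N ∧
    (∀ i : Fin c.N, m₀ ≤ c.mass i ∧ c.mass i ≤ m₀⁻¹ ∧ |c.spin i| ≤ χ * c.mass i) ∧
    O = 𝒟.toCauchyDevelopment.exteriorOf c.windowImage ∧
    O ⊆ 𝒟.metric.causalPast 𝒟.timeOrientation (c.certifiedSlab 0) ∪ c.windowImage

/-- **The development contains a closed trapped surface** (the BLACK-HOLE SIDE condition: an open,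
Cauchy-stable property — AKU 2026 Rem. 6 — false for every naked / overspun member, so it replaces
the one-sided smallness that ball basins cannot express, cf. `NakedMemberThresholds`). -/
def HasTrappedSurface {X : Type} [TopologicalSpace X] [ChartedSpace E3 X] [IsManifold (𝓡 3) ∞ X]
    [T2Space X] [SecondCountableTopology X] [ConnectedSpace X] {D : InitialDataSet (𝓡 3) X}
    (𝒟 : VacuumCauchyDevelopment D) : Prop :=
  haveI : 𝒟.metric.toPseudoRiemannianMetric.HasLeviCivita := 𝒟.metric.hasLeviCivita
  ∃ (S : Type) (_ : TopologicalSpace S) (_ : ChartedSpace (EuclideanSpace ℝ (Fin 2)) S)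
    (_ : IsManifold (𝓡 2) ∞ S) (f : S → 𝒟.carrier), 𝒟.metric.IsTrappedSurface (𝓡 2) 𝒟.timeOrientation f

/-- **Uniform ENTRY, orbital form (U_entry)** — the near-extremal input a TAME front end can
consume (AKU 2026 Thm 1 shape for Kerr, weakened to ORBITAL: no decay claimed), on the BLACK-HOLE
SIDE only (a closed trapped surface in the development; the overspun / non-collapse side is never
visited by the witnesses of cards 1–2): there is ONE accuracy `ε₀(N, m₀) > 0` (scale-free) such
that a censored development with a trapped surface, tracked ONCE at `(ε₀, L₀, R₀)` with no spin
margin (`χ = 1`), is tracked FOREVER (the tree's chained, exhausting, pinned, covered notion) at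
accuracy `C ε₀` for every window length `L` and radius floor `R`, still with `χ = 1`. Entry radius
uniform in `κ`; nothing about rates. -/
def UniformEntryOrbital : Prop :=
  ∀ (X : Type) [TopologicalSpace X] [ChartedSpace E3 X] [IsManifold (𝓡 3) ∞ X] [T2Space X]
    [SecondCountableTopology X] [ConnectedSpace X],
    ∀ (N : ℕ) (m₀ : ℝ), 0 < m₀ → ∃ (ε₀ : ℝ≥0∞) (C L₀ R₀ : ℝ), 0 < ε₀ ∧
      ∀ D ∈ admissibleVacuumData X, ∀ 𝒟 : VacuumCauchyDevelopment D, 𝒟.IsMaximal →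
        Summit.FinalStateConjecture.HasCompleteNullInfinity 𝒟.toCauchyDevelopment →
        HasTrappedSurface 𝒟 → TrackedOnce 𝒟 N m₀ 1 ε₀ L₀ R₀ →
          ∀ (L R : ℝ), 0 < L → 𝒟.IsAdiabaticallyTracked N (m₀ / 2) 1 (ENNReal.ofReal C * ε₀) L R

/-- **Polynomial DWELL (the route's currency, second factor)**: members that END sub-extremal
(some later window has spin bound `χ < 1`) become tracked at EVERY accuracy — with the waiting
time / constants allowed to degrade like a power of `(1 - χ)⁻¹` (not typed: the tree's tracking
predicate is qualitative in time; the power law is the expected shape of the proof, as in rank 3). -/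
def PolynomialDwell : Prop :=
  ∀ (X : Type) [TopologicalSpace X] [ChartedSpace E3 X] [IsManifold (𝓡 3) ∞ X] [T2Space X]
    [SecondCountableTopology X] [ConnectedSpace X],
    ∀ (N : ℕ) (m₀ : ℝ), 0 < m₀ → ∃ (ε₁ : ℝ≥0∞) (L₁ R₁ : ℝ), 0 < ε₁ ∧
      ∀ D ∈ admissibleVacuumData X, ∀ 𝒟 : VacuumCauchyDevelopment D, 𝒟.IsMaximal →
        Summit.FinalStateConjecture.HasCompleteNullInfinity 𝒟.toCauchyDevelopment →
        HasTrappedSurface 𝒟 →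
        ∀ χ : ℝ, 0 ≤ χ → χ < 1 → 𝒟.IsAdiabaticallyTracked N m₀ χ ε₁ L₁ R₁ →
          ∀ (L : ℝ) (ε : ℝ≥0∞) (R : ℝ), 0 < L → 0 < ε → 𝒟.IsAdiabaticallyTracked N (m₀ / 2) χ ε L R

/-- **The re-cut of the crux's large-data residue** ("enter once"): granted `UniformEntryOrbital`,
the quiet stub of the ported line (`∀ accuracy`) is implied by tracking ONCE at the uniform accuracy
plus un-parking inside the basin (cards 1–2) plus `PolynomialDwell`; so the only LARGE-DATA
statement left is: tame-generically (relative to censored curves), some window is `ε₀`-tracked. -/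
def EnterOnceResidue : Prop :=
  ∀ (X : Type) [TopologicalSpace X] [ChartedSpace E3 X] [IsManifold (𝓡 3) ∞ X] [T2Space X]
    [SecondCountableTopology X] [ConnectedSpace X],
    ∀ (ε₀ : ℝ≥0∞) (L₀ R₀ : ℝ), 0 < ε₀ →
      InitialDataSet.IsTameChristodoulouGeneric (admissibleVacuumData X)
        (fun D ↦ CensoredAt X D ∧ ∀ 𝒟 : VacuumCauchyDevelopment D, 𝒟.IsMaximal →
          ∃ (N : ℕ) (m₀ : ℝ), 0 < m₀ ∧ TrackedOnce 𝒟 N m₀ 1 ε₀ L₀ R₀) 1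

end EnterOnce

end Summit.FinalStateConjecture.FinalStateConjecture.Cruxes.CaptureSufficesTame.Ideator1

end
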